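import Summits.RiemannHypothesis.RiemannHypothesis.Theorems.EtaLeadingQuarterSecondMomentEngineBlock
import HarnessLib

/-!
# The sharp eta vector at the zeros — engine II: the pieces at a resonance
(route EtaLeadingQuarter, item `EtaLeadingSecondMoment`, stmt-RiemannHypothesis-21791)

RH-free bookkeeping for the resonant case of the truncation error `Q_X(s)` (`s = 1/2 + it`,
`y = t/(2πX)` with `|y − j| < 1/8`, `j ≥ 1`): the length is shifted down to `a = t/(2π(j+1/2))`,
`X' = [a] ∈ [X/2, X)` (`shift_shape`), the block `∑_{X'<n≤X} n^{−s}` costs `≤ 68/√X + 62/√y`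
(`norm_block_shift_le`, from part I), the extra dual term costs `≤ 1/√y` (`norm_dual_adjust_le`),
and `afe_shift_numeric` is the arithmetic of the gap AFE at `(X', a)`. Part III assembles the
uniform bound. Nothing here bears on the truth of RH.
-/

noncomputable section

open Real Finset Complex

set_option linter.dupNamespace false  -- the mandated namespace repeats `RiemannHypothesis`

namespace Summit.RiemannHypothesis.RiemannHypothesis.Theorems.EtaLeadingQuarter.Engine

open Literature.NumberTheory.LFunctions Literature.NumberTheory.LFunctions.VdC
  Literature.NumberTheory.LFunctions.AFE

/-! ## A resonance has a nearby integer -/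

/-- If `y > 7/8` is not at distance `≥ 1/8` from the integers inside `[1, ∞)`, then some integer
`j ≥ 1` has `|y − j| < 1/8`. [folklore] -/
theorem exists_nat_near {y : ℝ} (hy : 7 / 8 < y)
    (hC : y < 1 ∨ Int.fract y < 1 / 8 ∨ 7 / 8 < Int.fract y) :
    ∃ j : ℕ, 1 ≤ j ∧ |y - j| < 1 / 8 := by
  have hmin : min (Int.fract y) (1 - Int.fract y) < 1 / 8 := by
    rcases hC with h | h | h
    · have hf : Int.fract y = y := Int.fract_eq_self.2 ⟨by linarith, h⟩
      rw [hf]; exact min_lt_of_right_lt (by linarith)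
    · exact min_lt_of_left_lt h
    · exact min_lt_of_right_lt (by linarith)
  have habs : |y - round y| < 1 / 8 := by rw [abs_sub_round_eq_min]; exact hmin
  have h0 : (0 : ℤ) ≤ round y := by
    have h1 := (abs_lt.1 habs).2
    have h2 : (0 : ℝ) < (round y : ℝ) := by linarith
    exact_mod_cast h2.le
  have hcast : (((round y).toNat : ℕ) : ℝ) = ((round y : ℤ) : ℝ) := by
    exact_mod_cast Int.toNat_of_nonneg h0
  refine ⟨(round y).toNat, ?_, by rw [hcast]; exact habs⟩
  have h1 := (abs_lt.1 habs).2
  have h2 : (3 / 4 : ℝ) < (((round y).toNat : ℕ) : ℝ) := by rw [hcast]; linarith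
  have h3 : (0 : ℝ) < (((round y).toNat : ℕ) : ℝ) := by linarith
  exact Nat.one_le_iff_ne_zero.2 fun h ↦ by rw [h] at h3; simp at h3

/-! ## Elementary square-root bookkeeping -/

/-- `1/√a ≤ √2/√b` when `0 < b ≤ 2a`, `a > 0`. [folklore] -/
theorem one_div_sqrt_le_sqrt_two_div {a b : ℝ} (ha : 0 < a) (hb : 0 < b) (hab : b ≤ 2 * a) :
    1 / Real.sqrt a ≤ Real.sqrt 2 / Real.sqrt b := by
  rw [div_le_div_iff₀ (Real.sqrt_pos.2 ha) (Real.sqrt_pos.2 hb), one_mul]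
  calc Real.sqrt b ≤ Real.sqrt (2 * a) := Real.sqrt_le_sqrt hab
    _ = Real.sqrt 2 * Real.sqrt a := Real.sqrt_mul (by norm_num) a

/-- `√(a + c) / a ≤ √(1 + c/a₀) / √a` for `a ≥ a₀ > 0`, `c ≥ 0`. [folklore] -/
theorem sqrt_add_div_le {a a₀ c : ℝ} (ha₀ : 0 < a₀) (ha : a₀ ≤ a) (hc : 0 ≤ c) :
    Real.sqrt (a + c) / a ≤ Real.sqrt (1 + c / a₀) / Real.sqrt a := by
  have ha' : 0 < a := lt_of_lt_of_le ha₀ ha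
  have hsa : 0 < Real.sqrt a := Real.sqrt_pos.2 ha'
  rw [div_le_div_iff₀ ha' hsa]
  have e : Real.sqrt (1 + c / a₀) * a = Real.sqrt ((1 + c / a₀) * a) * Real.sqrt a := by
    rw [Real.sqrt_mul (by positivity) a, mul_assoc, Real.mul_self_sqrt ha'.le]
  rw [e]
  refine mul_le_mul_of_nonneg_right (Real.sqrt_le_sqrt ?_) hsa.le
  have : c ≤ c / a₀ * a := by
    rw [div_mul_eq_mul_div, le_div_iff₀ ha₀]
    exact mul_le_mul_of_nonneg_left ha hc
  nlinarith

/-! ## The two pieces at a resonance, in numerical form -/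

/-- `log 3 ≤ 7/5`. [folklore] -/
theorem log_three_le : Real.log 3 ≤ 7 / 5 := by
  have h4 : Real.log 3 ≤ Real.log 4 := Real.log_le_log (by norm_num) (by norm_num)
  have e : Real.log 4 = 2 * Real.log 2 := by
    rw [show (4 : ℝ) = 2 ^ 2 by norm_num, Real.log_pow]; push_cast; ring
  linarith [Real.log_two_lt_d9]

/-- First piece of the block bound (pure bookkeeping). [folklore] -/
theorem block_piece_one {w sj sX sy X X' jh : ℝ} (hsX : 0 < sX) (hsy : 0 < sy) (hX' : 0 < X')
    (hjh : 0 < jh) (hsj : 0 ≤ sj) (hw : w ≤ sj / (sX * sy))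
    (hL : X - X' ≤ 5 / 8 * X / jh + 1) (hL0 : 0 ≤ X - X') (hXX' : X ≤ 2 * X')
    (hjinv : sj / jh ≤ 1 / sy) (hjX : sj ≤ Real.sqrt 2 * sX) (hsXX : sX * sX = X) :
    w * (2 * (X - X') * (sX * sy) / X') ≤ 5 / 2 / sy + 4 * Real.sqrt 2 / sX := by
  have hX0 : 0 < X := by rw [← hsXX]; positivity
  have step1 : w * (2 * (X - X') * (sX * sy) / X') ≤
      sj / (sX * sy) * (2 * (5 / 8 * X / jh + 1) * (sX * sy) / X') := by
    gcongr
  have step2 : sj / (sX * sy) * (2 * (5 / 8 * X / jh + 1) * (sX * sy) / X') =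
      5 / 4 * ((X / X') * (sj / jh)) + 2 * (sj / X') := by
    field_simp
    ring
  have hXX'' : X / X' ≤ 2 := by rw [div_le_iff₀ hX']; linarith
  have step3 : (X / X') * (sj / jh) ≤ 2 * (1 / sy) :=
    mul_le_mul hXX'' hjinv (by positivity) (by norm_num)
  have step4 : sj / X' ≤ Real.sqrt 2 * sX / (X / 2) :=
    div_le_div₀ (by positivity) hjX (by positivity) (by linarith)
  have step5 : Real.sqrt 2 * sX / (X / 2) = 2 * Real.sqrt 2 / sX := by
    rw [← hsXX]; field_simp
  rw [step5] at step4
  calc w * (2 * (X - X') * (sX * sy) / X') ≤ 5 / 4 * ((X / X') * (sj / jh)) + 2 * (sj / X') :=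
        step1.trans step2.le
    _ ≤ 5 / 4 * (2 * (1 / sy)) + 2 * (2 * Real.sqrt 2 / sX) := by gcongr
    _ = 5 / 2 / sy + 4 * Real.sqrt 2 / sX := by ring

/-- Second piece of the block bound (pure bookkeeping). [folklore] -/
theorem block_piece_two {w sj sX sy X X' y : ℝ} (hsX : 0 < sX) (hsy : 0 < sy) (hX' : 0 ≤ X')
    (hsj : 0 ≤ sj) (hw : w ≤ sj / (sX * sy)) (hX'X : X' ≤ X)
    (hsXX : sX * sX = X) (hsyy : sy * sy = y) (hjy : sj / y ≤ 131 / 100 / sy) :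
    w * (2 * X' / (sX * sy)) ≤ 2 * (131 / 100) / sy := by
  have hX0 : 0 < X := by rw [← hsXX]; positivity
  have hy0 : 0 < y := by rw [← hsyy]; positivity
  have step1 : w * (2 * X' / (sX * sy)) ≤ sj / (sX * sy) * (2 * X / (sX * sy)) := by gcongr
  have step2 : sj / (sX * sy) * (2 * X / (sX * sy)) = 2 * (sj / y) := by
    rw [← hsXX, ← hsyy]; field_simp
  calc w * (2 * X' / (sX * sy)) ≤ 2 * (sj / y) := step1.trans step2.le
    _ ≤ 2 * (131 / 100 / sy) := by gcongr
    _ = 2 * (131 / 100) / sy := by ring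

/-- Shape facts at a resonance: with `t = 2πXy`, `7/8 < y ≤ X`, `|y − j| < 1/8`, `a = Xy/(j+1/2)`
and `X' = [a]`: `X/2 ≤ X'`, `X' < X`, `7X/12 ≤ a < X`. [folklore] -/
theorem shift_shape {y a : ℝ} {X X' j : ℕ} (hX16 : (16 : ℝ) ≤ X) (hy : 7 / 8 < y)
    (hjy1 : -(1 / 8) < y - j) (hjy2 : y - j < 1 / 8) (ha : a = X * y / (j + 1 / 2))
    (hX'a : (X' : ℝ) ≤ a) (haX' : a < X' + 1) :
    a < X ∧ 7 / 12 * (X : ℝ) ≤ a ∧ (X : ℝ) ≤ 2 * X' ∧ X' ≤ X ∧ 1 ≤ X' ∧ (1 : ℝ) ≤ j := by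
  have hX0 : (0 : ℝ) < X := by linarith
  have hjR : (0 : ℝ) ≤ j := Nat.cast_nonneg j
  have hj0 : (0 : ℝ) < j + 1 / 2 := by linarith
  have hj1 : (1 : ℝ) ≤ j := by
    have h : (0 : ℝ) < j := by linarith
    have h' : 0 < j := by exact_mod_cast h
    exact_mod_cast h'
  have haX : a < X := by rw [ha, div_lt_iff₀ hj0]; nlinarith
  have halo : 7 / 12 * (X : ℝ) ≤ a := by
    rw [ha, le_div_iff₀ hj0]
    have h : 7 / 12 * ((j : ℝ) + 1 / 2) ≤ y := by linarith
    nlinarith [mul_le_mul_of_nonneg_left h hX0.le]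
  have hX'X : X' ≤ X := by exact_mod_cast (show (X' : ℝ) < X by linarith).le
  have hX'half : (X : ℝ) ≤ 2 * X' := by linarith
  have hX'1 : 1 ≤ X' := by
    have : X ≤ 2 * X' := by exact_mod_cast hX'half
    have h16 : 16 ≤ X := by exact_mod_cast hX16
    omega
  exact ⟨haX, halo, hX'half, hX'X, hX'1, hj1⟩

/-- **The block at a resonance.** With `t = 2πXy`, `7/8 < y ≤ X`, `|y − j| < 1/8`,
`a = Xy/(j+1/2)` and `X' = [a]` (so `X/2 ≤ X' ≤ X`):
`‖∑_{X'<n≤X} n^{−1/2−it}‖ ≤ 68/√X + 62/√y`. [folklore] -/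
theorem norm_block_shift_le {t y a : ℝ} {X X' j : ℕ} (ht : 0 < t) (hX16 : (16 : ℝ) ≤ X)
    (htXy : t = 2 * π * X * y) (hy : 7 / 8 < y) (hyX : y ≤ X) (hjy1 : -(1 / 8) < y - j)
    (hjy2 : y - j < 1 / 8) (ha : a = X * y / (j + 1 / 2)) (hX'a : (X' : ℝ) ≤ a) (haX' : a < X' + 1) :
    ‖∑ n ∈ Finset.Ioc X' X, (n : ℂ) ^ (-((1 / 2 : ℂ) + t * I))‖ ≤
      68 / Real.sqrt X + 62 / Real.sqrt y := by
  obtain ⟨haX, halo, hX'half, hX'X, hX'1, hj1⟩ := shift_shape hX16 hy hjy1 hjy2 ha hX'a haX'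
  have hX0 : (0 : ℝ) < X := by linarith
  have hy0 : 0 < y := by linarith
  have hjR : (0 : ℝ) ≤ j := Nat.cast_nonneg j
  have hj0 : (0 : ℝ) < j + 1 / 2 := by linarith
  have ha0 : 0 < a := by rw [ha]; positivity
  have hX2X' : X ≤ 2 * X' := by exact_mod_cast hX'half
  have hX'Xr : (X' : ℝ) ≤ X := by exact_mod_cast hX'X
  have hX'0 : (0 : ℝ) < X' := by exact_mod_cast (show 0 < X' by omega)
  have hsX : 0 < Real.sqrt X := Real.sqrt_pos.2 hX0
  have hsy : 0 < Real.sqrt y := Real.sqrt_pos.2 hy0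
  have hsj : 0 < Real.sqrt ((j : ℝ) + 1 / 2) := Real.sqrt_pos.2 hj0
  refine (norm_sum_Ioc_cpow_le ht hX'1 hX'X hX2X').trans ?_
  have htq : t / (2 * π) = X * y := by rw [htXy]; field_simp
  have hsl : Real.sqrt (t / (2 * π) / (2 * X') ^ 2) = Real.sqrt X * Real.sqrt y / (2 * X') := by
    rw [htq, Real.sqrt_div' _ (by positivity), Real.sqrt_sq (by positivity), Real.sqrt_mul hX0.le]
  have hp1 : ((X' : ℝ) + 1) ^ (-(1 / 2 : ℝ)) = 1 / Real.sqrt (X' + 1) := by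
    rw [Real.rpow_neg (by positivity), ← Real.sqrt_eq_rpow, one_div]
  rw [hsl, hp1]
  have hsa_eq : Real.sqrt a = Real.sqrt X * Real.sqrt y / Real.sqrt (j + 1 / 2) := by
    rw [ha, Real.sqrt_div' _ hj0.le, Real.sqrt_mul hX0.le]
  set w : ℝ := 1 / Real.sqrt ((X' : ℝ) + 1) with hwdef
  have hw : w ≤ Real.sqrt (j + 1 / 2) / (Real.sqrt X * Real.sqrt y) := by
    calc w ≤ 1 / Real.sqrt a :=
          div_le_div_of_nonneg_left zero_le_one (Real.sqrt_pos.2 ha0) (Real.sqrt_le_sqrt haX'.le)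
      _ = Real.sqrt (j + 1 / 2) / (Real.sqrt X * Real.sqrt y) := by
          rw [hsa_eq, one_div, inv_div]
  have hL : (X : ℝ) - X' ≤ 5 / 8 * X / (j + 1 / 2) + 1 := by
    have h1 : (X : ℝ) - a = X * ((j : ℝ) + 1 / 2 - y) / (j + 1 / 2) := by
      rw [ha]; field_simp
    have h2 : (X : ℝ) * ((j : ℝ) + 1 / 2 - y) / (j + 1 / 2) ≤ 5 / 8 * X / (j + 1 / 2) := by
      apply div_le_div_of_nonneg_right _ hj0.le
      nlinarith
    linarith
  have hL0 : 0 ≤ (X : ℝ) - X' := by linarith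
  have hjX : Real.sqrt ((j : ℝ) + 1 / 2) ≤ Real.sqrt 2 * Real.sqrt X := by
    rw [← Real.sqrt_mul (by norm_num)]
    exact Real.sqrt_le_sqrt (by linarith)
  have hjinv : Real.sqrt ((j : ℝ) + 1 / 2) / (j + 1 / 2) ≤ 1 / Real.sqrt y := by
    rw [div_le_div_iff₀ hj0 hsy]
    calc Real.sqrt ((j : ℝ) + 1 / 2) * Real.sqrt y
        ≤ Real.sqrt (j + 1 / 2) * Real.sqrt (j + 1 / 2) :=
          mul_le_mul_of_nonneg_left (Real.sqrt_le_sqrt (by linarith)) hsj.le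
      _ = 1 * ((j : ℝ) + 1 / 2) := by rw [one_mul, Real.mul_self_sqrt hj0.le]
  have hjy' : Real.sqrt ((j : ℝ) + 1 / 2) / y ≤ 131 / 100 / Real.sqrt y := by
    have h := sqrt_add_div_le (a₀ := 7 / 8) (a := y) (c := (j : ℝ) + 1 / 2 - y) (by norm_num)
      hy.le (by linarith)
    rw [show y + ((j : ℝ) + 1 / 2 - y) = j + 1 / 2 by ring] at h
    refine h.trans (div_le_div_of_nonneg_right ?_ hsy.le)
    have h5 : 1 + ((j : ℝ) + 1 / 2 - y) / (7 / 8) ≤ (131 / 100) ^ 2 := by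
      have : ((j : ℝ) + 1 / 2 - y) / (7 / 8) ≤ (5 / 8) / (7 / 8) :=
        div_le_div_of_nonneg_right (by linarith) (by norm_num)
      norm_num at this ⊢; linarith
    calc Real.sqrt (1 + ((j : ℝ) + 1 / 2 - y) / (7 / 8)) ≤ Real.sqrt ((131 / 100) ^ 2) :=
          Real.sqrt_le_sqrt h5
      _ = 131 / 100 := Real.sqrt_sq (by norm_num)
  have e1 : w * (12 * (4 * ((X : ℝ) - X') * (Real.sqrt X * Real.sqrt y / (2 * X')) +
        1 / (Real.sqrt X * Real.sqrt y / (2 * X')))) =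
      12 * (w * (2 * ((X : ℝ) - X') * (Real.sqrt X * Real.sqrt y) / X') +
        w * (2 * X' / (Real.sqrt X * Real.sqrt y))) := by
    field_simp
    ring
  rw [e1]
  have hP1 := block_piece_one hsX hsy hX'0 hj0 hsj.le hw hL hL0 hX'half hjinv hjX
    (Real.mul_self_sqrt hX0.le)
  have hP2 := block_piece_two hsX hsy hX'0.le hsj.le hw hX'Xr (Real.mul_self_sqrt hX0.le)
    (Real.mul_self_sqrt hy0.le) hjy'
  have hs2 : Real.sqrt 2 ≤ 17 / 12 := by
    rw [Real.sqrt_le_left (by norm_num)]; norm_num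
  have h1 : 12 * (4 * Real.sqrt 2 / Real.sqrt X) ≤ 68 / Real.sqrt X := by
    rw [← mul_div_assoc]; exact div_le_div_of_nonneg_right (by nlinarith) hsX.le
  have h2 : 12 * (5 / 2 / Real.sqrt y + 2 * (131 / 100) / Real.sqrt y) ≤ 62 / Real.sqrt y := by
    rw [← add_div, ← mul_div_assoc]; exact div_le_div_of_nonneg_right (by norm_num) hsy.le
  linarith [mul_le_mul_of_nonneg_left (add_le_add hP1 hP2) (show (0 : ℝ) ≤ 12 by norm_num)]

/-- **The dual adjustment at a resonance**: for `s = 1/2 + it`, `y > 0` and an integer `j` with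
`|y − j| < 1/8` (so `[y] ∈ {j−1, j}`), `‖afeCoeff(s) (D(j) − D([y]))‖ ≤ 1/√y` where
`D(m) = ∑_{n≤m} n^{s−1}` (the difference is empty or the single term `j^{s−1}`, `j > y`). [folklore] -/
theorem norm_dual_adjust_le {t y : ℝ} {j : ℕ} (hy0 : 0 < y) (hjy1 : -(1 / 8) < y - j)
    (hjy2 : y - j < 1 / 8) (s : ℂ) (hs : s = 1 / 2 + t * I) :
    ‖afeCoeff s * (∑ n ∈ Finset.Icc 1 j, (n : ℂ) ^ (s - 1) -
        ∑ n ∈ Finset.Icc 1 ⌊y⌋₊, (n : ℂ) ^ (s - 1))‖ ≤ 1 / Real.sqrt y := by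
  have hsy : 0 < Real.sqrt y := Real.sqrt_pos.2 hy0
  have hm1 : ⌊y⌋₊ ≤ j := by
    have : ⌊y⌋₊ < j + 1 := (Nat.floor_lt hy0.le).2 (by push_cast; linarith)
    omega
  have hm2 : j ≤ ⌊y⌋₊ + 1 := by
    have := Nat.lt_floor_add_one y
    have h2 : (j : ℝ) < (⌊y⌋₊ : ℝ) + 1 + 1 := by linarith
    have h3 : j < ⌊y⌋₊ + 1 + 1 := by exact_mod_cast h2
    omega
  rcases Nat.eq_or_lt_of_le hm1 with heq | hlt
  · rw [heq, sub_self, mul_zero, norm_zero]; positivity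
  · have hjeq : j = ⌊y⌋₊ + 1 := by omega
    have hyj : y < j := by
      have := Nat.lt_floor_add_one y
      rw [hjeq]; push_cast; linarith
    rw [hjeq, Finset.sum_Icc_succ_top (by omega), add_sub_cancel_left, norm_mul, ← hjeq]
    have hC1 : ‖afeCoeff s‖ ≤ 1 := by rw [hs]; exact norm_afeCoeff_half_le_one t
    have hj0' : 0 < j := by omega
    have hjn : ‖(j : ℂ) ^ (s - 1)‖ = 1 / Real.sqrt j := by
      rw [Complex.norm_natCast_cpow_of_pos hj0', show (s - 1).re = -(1 / 2) by
        rw [hs]; simp; norm_num, Real.rpow_neg (Nat.cast_nonneg j), ← Real.sqrt_eq_rpow, one_div]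
    rw [hjn]
    have hyj' : 1 / Real.sqrt j ≤ 1 / Real.sqrt y :=
      div_le_div_of_nonneg_left zero_le_one hsy (Real.sqrt_le_sqrt hyj.le)
    calc ‖afeCoeff s‖ * (1 / Real.sqrt j) ≤ 1 * (1 / Real.sqrt j) :=
          mul_le_mul_of_nonneg_right hC1 (by positivity)
      _ ≤ 1 / Real.sqrt y := by rw [one_mul]; exact hyj'

/-- Numerical form of the shifted gap AFE bound (pure bookkeeping). [folklore] -/
theorem afe_shift_numeric {sX sX' sa L Ly : ℝ} (hsX : 0 < sX)
    (hsX' : 1 / sX' ≤ Real.sqrt 2 / sX) (hsa : 1 / sa ≤ Real.sqrt 2 / sX) (hL0 : 0 ≤ L)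
    (hL : L ≤ 7 / 5 + Ly) (hLy : 0 ≤ Ly) :
    4 * (1 / sX') + 1 / sa * (2 / (1 / 2) + 9 + 4 * L) ≤ (33 + 6 * Ly) / sX := by
  have hs2 : Real.sqrt 2 ≤ 17 / 12 := by
    rw [Real.sqrt_le_left (by norm_num)]; norm_num
  have h20 : 0 ≤ Real.sqrt 2 := Real.sqrt_nonneg 2
  have hx1 : 4 * (1 / sX') ≤ 4 * (Real.sqrt 2 / sX) := by linarith
  have hB0 : (0 : ℝ) ≤ 2 / (1 / 2) + 9 + 4 * L := by norm_num; linarith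
  have hx2 : 1 / sa * (2 / (1 / 2) + 9 + 4 * L) ≤ Real.sqrt 2 / sX * (13 + 4 * (7 / 5 + Ly)) :=
    mul_le_mul hsa (by norm_num; linarith) hB0 (by positivity)
  have hx4 : Real.sqrt 2 * (113 / 5 + 4 * Ly) ≤ 33 + 6 * Ly := by nlinarith
  have hx3 : 4 * (Real.sqrt 2 / sX) + Real.sqrt 2 / sX * (13 + 4 * (7 / 5 + Ly)) =
      Real.sqrt 2 * (113 / 5 + 4 * Ly) / sX := by ring
  have hx5 := div_le_div_of_nonneg_right hx4 hsX.le
  linarith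

end Summit.RiemannHypothesis.RiemannHypothesis.Theorems.EtaLeadingQuarter.Engine

end
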